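import Summits.QuantumFields.BalabanUV.Beta.D1BFx.WardJetsFromNoether

/-!
# `BalabanUV.Beta.D1BFx.WardJetsSourcesParity` — road «BF-x» for binder row D1, slot (K), identity side: **«WARD-L WITH SOURCES»** PART 1b —
# THE PARITY CONSTRAINT (Q-WL-2 in kernel form): the K-letter with source `Kₛ·W₀ + K₀·Wₛ = −E` of `WardJetsSources.wardSrc₁` forces the sandwich
# `W₀ᵀ·Kₛ·W₀ = −W₀ᵀ·E`; an ANTISYMMETRIC (parity-typed) `Kₛ` needs its symmetric part to vanish — which for a gradient slice `W₀ = D·N` HOLDS under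
# the MIDPOINT read-out (`K₀·D = 0`) and FAILS under the TIP read-out unless the Hadamard word `Σ_j K₀[j,s]·W₀[j,a]·W₀[j,a′]` vanishes

HONEST DEPENDENCY (cell records, verbatim): «continuum YM on T⁴ ⇐ BetaPertH ∧ nine spine estimates (0/9 proved); BetaPertH ⇐ (D1) ∧ (D4) ∧
CAP+tail; G-an2-4 gates asym, D1 and NE2/3/4.»  HONEST FRAMING (cell contract, verbatim): «discharging `BetaPertH` makes Bałaban's UV stability
UNCONDITIONAL — a real constructive-QFT result; it is NOT the continuum limit and NOT the Clay problem.»  THIS MODULE DISCHARGES NOTHING of (K),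
of D1 or of the wall: [folklore] finite-dimensional matrix algebra (Mathlib) on ABSTRACT data.  No `def`, no `def … : Prop`, nothing cited,
0 sorry; no table of the cell is instantiated.  0 binders discharged; (K) NOT closed; NOT D1, NOT BetaPertH, NOT continuum, NOT Clay.

ABSOLUTE RULE (cell charter, verbatim): «No internally-minted statement may enter as a cited fact. Every hypothesis is either kernel-proved in this
package or a verbatim quotation of a PUBLISHED theorem with page reference. The manuscript(s) under audit are NOT citable for their own disputed
steps — they are the thing under adjudication; programme-internal (2001/route/tribunal) claims are never citable.»

WHY (TOY VERDICT T-d1leaf03g13-WARDL l.32072, owner RULING ρ-g11-7 l.32217 «the MIDPOINT read-out makes `sym Tₖ = 0` exactly but not `Tₖ` … the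
TIP convention's parity inconsistency with `hkₛ : kₛᵀ = −kₛ` is a second located item for an2 (Q-WL-2)»).  (A1) types the literal's first jets
`kₛ` ANTISYMMETRIC.  From [P1] one has, for symmetric `K₀` with `K₀·W₀ = 0`, the sandwich `W₀ᵀ·Kₛ·W₀ = −Tₛ`, `Tₛ := W₀ᵀ·(K₀[j,s]·Nt[j,a])_{j,a}` (§1);
antisymmetry of `Kₛ` then forces `Tₛ + Tₛᵀ = 0` (§1).  For a gradient slice `W₀ = D·N` over bond endpoint maps `tip base` the symmetric part is,
entrywise, `Σ_j K₀[j,s]·(D(N_a ⊙ N_a′))_j` under the MIDPOINT weight `Nt = ½(N∘tip + N∘base)` (the lattice product rule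
`f(t)g(t) − f(b)g(b) = ½(f(t)+f(b))·δg + ½(g(t)+g(b))·δf`) and `Σ_j K₀[j,s]·((D(N_a ⊙ N_a′))_j + W₀[j,a]·W₀[j,a′])` under the TIP weight `Nt = N∘tip`
(`f(t)·δg + g(t)·δf = δ(fg) + δf·δg`) (§2).  Hence with `K₀·D = 0` (`d*d ∘ d = 0` on ALL functions): midpoint ⟹ no constraint (§3
`symPart_midpoint_eq_zero`); tip ⟹ the HADAMARD CONSTRAINT `Σ_j K₀[j,s]·W₀[j,a]·W₀[j,a′] = 0 ∀ a a′` (§3 `hadamard_of_tip_antisymm`) — the toy's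
`5∕4 ≠ 0` on the 4×4 torus with `K₀ = d*d`, so there NO antisymmetric `kₛ` satisfies [P1] under the tip read-out.  Symmetric `Kₛ`: `Tₛᵀ = Tₛ` (§1).
CONTENT (all [folklore]): §1 `sandwich_of_letter`, `sandwich_add_transpose_of_antisymm`, `sandwich_transpose_of_symm`; §2 `symPart_midpoint`,
`symPart_tip`; §3 `symPart_midpoint_eq_zero`, `hadamard_of_tip_antisymm`.  NOT HERE (honest): the road's torus instance (PART 2
`WardJetsSourcesTorus`), any decision on Q-WL-2 (an2's), the value of the Hadamard word on the road's tori (a computation, not a theorem here).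
Unit `b2b-balaban-beta-d1-formalise-leaf-03` (gen 14), D1 formalisation swarm LEAF PROVER 03; road owner `b2b-balaban-beta-d1-p2`.
-/

noncomputable section

namespace Summit.QuantumFields.BalabanUV.Beta.D1BFx.WardJetsSourcesParity

open Matrix
open scoped BigOperators

variable {ν ρ : Type*}

/-! ## §1 The sandwich of the K-letter with source and its parity types -/

section Parity

variable [Fintype ν]

/-- [folklore] **THE SANDWICH OF THE K-LETTER WITH SOURCE.**  For symmetric `K₀` with `K₀·W₀ = 0`, the letter `Kₛ·W₀ + K₀·Wₛ = −E` gives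
`W₀ᵀ·Kₛ·W₀ = −W₀ᵀ·E` (the gauge-jet term drops: `W₀ᵀK₀ = 0`). -/
theorem sandwich_of_letter (K₀ Kₛ : Matrix ν ν ℝ) (W₀ Wₛ E : Matrix ν ρ ℝ) (hK₀ : K₀ᵀ = K₀) (a0 : K₀ * W₀ = 0)
    (h : Kₛ * W₀ + K₀ * Wₛ = -E) : W₀ᵀ * Kₛ * W₀ = -(W₀ᵀ * E) := by
  have hWK : W₀ᵀ * K₀ = 0 := by
    have := congrArg Matrix.transpose a0
    rwa [Matrix.transpose_mul, hK₀, Matrix.transpose_zero] at this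
  have h2 := congrArg (fun M => W₀ᵀ * M) h
  simp only [Matrix.mul_add, Matrix.mul_neg, ← Matrix.mul_assoc, hWK, Matrix.zero_mul, add_zero] at h2
  exact h2

/-- [folklore] PARITY-TYPED, ODD: an ANTISYMMETRIC `Kₛ` with sandwich `W₀ᵀ·Kₛ·W₀ = −T` forces `T + Tᵀ = 0`. -/
theorem sandwich_add_transpose_of_antisymm (Kₛ : Matrix ν ν ℝ) (W₀ : Matrix ν ρ ℝ) (T : Matrix ρ ρ ℝ) (hKₛ : Kₛᵀ = -Kₛ)
    (hS : W₀ᵀ * Kₛ * W₀ = -T) : T + Tᵀ = 0 := by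
  have ht : (W₀ᵀ * Kₛ * W₀)ᵀ = -(W₀ᵀ * Kₛ * W₀) := by
    rw [Matrix.transpose_mul, Matrix.transpose_mul, Matrix.transpose_transpose, hKₛ, Matrix.neg_mul, Matrix.mul_neg, Matrix.mul_assoc]
  rw [hS, Matrix.transpose_neg, neg_neg] at ht
  calc T + Tᵀ = -Tᵀ + Tᵀ := by rw [ht]
    _ = 0 := neg_add_cancel _

/-- [folklore] PARITY-TYPED, EVEN: a SYMMETRIC `Kₛ` with sandwich `W₀ᵀ·Kₛ·W₀ = −T` forces `Tᵀ = T`. -/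
theorem sandwich_transpose_of_symm (Kₛ : Matrix ν ν ℝ) (W₀ : Matrix ν ρ ℝ) (T : Matrix ρ ρ ℝ) (hKₛ : Kₛᵀ = Kₛ)
    (hS : W₀ᵀ * Kₛ * W₀ = -T) : Tᵀ = T := by
  have ht : (W₀ᵀ * Kₛ * W₀)ᵀ = W₀ᵀ * Kₛ * W₀ := by
    rw [Matrix.transpose_mul, Matrix.transpose_mul, Matrix.transpose_transpose, hKₛ, Matrix.mul_assoc]
  rw [hS, Matrix.transpose_neg] at ht
  exact neg_injective ht

/-! ## §2 The symmetric part of the source sandwich for a gradient slice: midpoint vs tip read-out -/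

variable {X : Type*} [Fintype X] [DecidableEq X]

/-- [folklore] **THE SYMMETRIC PART OF THE SOURCE SANDWICH, MIDPOINT READ-OUT.**  For a GRADIENT slice `W₀ = D·N` over endpoint maps
`tip base : ν → X` (`D j z = [z = tip j] − [z = base j]`) and the MIDPOINT weight `Nt j a = ½(N (tip j) a + N (base j) a)`, the sandwich
`Tₛ := W₀ᵀ·(K₀ j s·Nt j a)_{j,a}` has symmetric part `(Tₛ + Tₛᵀ) a′ a = Σ_j K₀ j s·(D·(N_a ⊙ N_a′))_j` — the lattice product rule
`f(t)g(t) − f(b)g(b) = ½(f(t)+f(b))(g(t)−g(b)) + ½(g(t)+g(b))(f(t)−f(b))`. -/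
theorem symPart_midpoint (K₀ : Matrix ν ν ℝ) (D : Matrix ν X ℝ) (N : Matrix X ρ ℝ) (tip base : ν → X)
    (hD : ∀ j z, D j z = (if z = tip j then (1 : ℝ) else 0) - (if z = base j then 1 else 0))
    (Nt : ν → ρ → ℝ) (hNt : ∀ j a, Nt j a = (N (tip j) a + N (base j) a) / 2) (s : ν) (a a' : ρ) :
    ((D * N)ᵀ * Matrix.of (fun j a => K₀ j s * Nt j a) + ((D * N)ᵀ * Matrix.of (fun j a => K₀ j s * Nt j a))ᵀ) a' a
      = ∑ j, K₀ j s * (D *ᵥ fun z => N z a * N z a') j := by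
  have hDN : ∀ j c, (D * N) j c = N (tip j) c - N (base j) c := by
    intro j c
    rw [Matrix.mul_apply]
    simp only [hD, sub_mul, Finset.sum_sub_distrib, ite_mul, one_mul, zero_mul, Finset.sum_ite_eq', Finset.mem_univ, if_true]
  have hDv : ∀ j, (D *ᵥ fun z => N z a * N z a') j = N (tip j) a * N (tip j) a' - N (base j) a * N (base j) a' := by
    intro j
    simp only [Matrix.mulVec, dotProduct, hD, sub_mul, Finset.sum_sub_distrib, ite_mul, one_mul, zero_mul, Finset.sum_ite_eq',
      Finset.mem_univ, if_true]
  rw [Matrix.add_apply, Matrix.transpose_apply, Matrix.mul_apply, Matrix.mul_apply, ← Finset.sum_add_distrib]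
  refine Finset.sum_congr rfl fun j _ => ?_
  rw [Matrix.transpose_apply, Matrix.transpose_apply, Matrix.of_apply, Matrix.of_apply, hDN, hDN, hNt, hNt, hDv]
  ring

/-- [folklore] **THE SYMMETRIC PART OF THE SOURCE SANDWICH, TIP READ-OUT** (THE CONVENTION of record): the same gradient slice with the TIP weight
`Nt j a = N (tip j) a` gives `(Tₛ + Tₛᵀ) a′ a = Σ_j K₀ j s·((D·(N_a ⊙ N_a′))_j + W₀ j a·W₀ j a′)` — the extra HADAMARD word
(`f(t)(g(t)−g(b)) + g(t)(f(t)−f(b)) = [fg](t) − [fg](b) + (f(t)−f(b))(g(t)−g(b))`). -/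
theorem symPart_tip (K₀ : Matrix ν ν ℝ) (D : Matrix ν X ℝ) (N : Matrix X ρ ℝ) (tip base : ν → X)
    (hD : ∀ j z, D j z = (if z = tip j then (1 : ℝ) else 0) - (if z = base j then 1 else 0))
    (Nt : ν → ρ → ℝ) (hNt : ∀ j a, Nt j a = N (tip j) a) (s : ν) (a a' : ρ) :
    ((D * N)ᵀ * Matrix.of (fun j a => K₀ j s * Nt j a) + ((D * N)ᵀ * Matrix.of (fun j a => K₀ j s * Nt j a))ᵀ) a' a
      = ∑ j, K₀ j s * ((D *ᵥ fun z => N z a * N z a') j + (D * N) j a * (D * N) j a') := by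
  have hDN : ∀ j c, (D * N) j c = N (tip j) c - N (base j) c := by
    intro j c
    rw [Matrix.mul_apply]
    simp only [hD, sub_mul, Finset.sum_sub_distrib, ite_mul, one_mul, zero_mul, Finset.sum_ite_eq', Finset.mem_univ, if_true]
  have hDv : ∀ j, (D *ᵥ fun z => N z a * N z a') j = N (tip j) a * N (tip j) a' - N (base j) a * N (base j) a' := by
    intro j
    simp only [Matrix.mulVec, dotProduct, hD, sub_mul, Finset.sum_sub_distrib, ite_mul, one_mul, zero_mul, Finset.sum_ite_eq',
      Finset.mem_univ, if_true]
  rw [Matrix.add_apply, Matrix.transpose_apply, Matrix.mul_apply, Matrix.mul_apply, ← Finset.sum_add_distrib]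
  refine Finset.sum_congr rfl fun j _ => ?_
  rw [Matrix.transpose_apply, Matrix.transpose_apply, Matrix.of_apply, Matrix.of_apply, hDN, hDN, hNt, hNt, hDv]
  ring

/-! ## §3 Consequences under `K₀·D = 0`: midpoint — none; tip — the Hadamard constraint -/

/-- [folklore] **MIDPOINT ⟹ NO PARITY CONSTRAINT.**  If moreover `K₀` is symmetric and kills the FULL gradient (`K₀·D = 0`: `d*d ∘ d = 0` on all
functions, not only on the slice), the symmetric part of the midpoint sandwich VANISHES — antisymmetric `Kₛ` are consistent with [P1]. -/
theorem symPart_midpoint_eq_zero (K₀ : Matrix ν ν ℝ) (D : Matrix ν X ℝ) (N : Matrix X ρ ℝ) (tip base : ν → X)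
    (hD : ∀ j z, D j z = (if z = tip j then (1 : ℝ) else 0) - (if z = base j then 1 else 0))
    (Nt : ν → ρ → ℝ) (hNt : ∀ j a, Nt j a = (N (tip j) a + N (base j) a) / 2) (hK₀ : K₀ᵀ = K₀) (hKD : K₀ * D = 0) (s : ν) :
    (D * N)ᵀ * Matrix.of (fun j a => K₀ j s * Nt j a) + ((D * N)ᵀ * Matrix.of (fun j a => K₀ j s * Nt j a))ᵀ = 0 := by
  ext a' a
  rw [symPart_midpoint K₀ D N tip base hD Nt hNt s a a', Matrix.zero_apply]
  have h : ∀ j, K₀ j s = K₀ s j := fun j => by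
    have e := congrFun (congrFun hK₀ s) j
    rw [Matrix.transpose_apply] at e
    exact e
  simp_rw [h]
  have := congrFun (congrArg (fun M : Matrix ν X ℝ => M *ᵥ fun z => N z a * N z a') hKD) s
  simp only [Matrix.zero_mulVec, Pi.zero_apply, ← Matrix.mulVec_mulVec] at this
  rw [Matrix.mulVec, dotProduct] at this
  exact this

/-- [folklore] **TIP ⟹ THE HADAMARD CONSTRAINT (Q-WL-2).**  Under the TIP read-out, a symmetric `K₀` killing the full gradient, `K₀·W₀ = 0`
(`W₀ = D·N`) and an ANTISYMMETRIC `Kₛ` satisfying the letter with source force `Σ_j K₀ j s·W₀ j a·W₀ j a′ = 0` for all `a a′` — the Hadamard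
products of the slice columns lie in `ker K₀` at row `s`.  (T-d1leaf03g13-WARDL: this FAILS for `K₀ = d*d`, `W₀ = grad` of the block-mean-free
functions on the 4×4 torus — value `5∕4`; so no antisymmetric `Kₛ` satisfies [P1] under the tip read-out there.) -/
theorem hadamard_of_tip_antisymm (K₀ Kₛ : Matrix ν ν ℝ) (D : Matrix ν X ℝ) (N : Matrix X ρ ℝ) (tip base : ν → X)
    (hD : ∀ j z, D j z = (if z = tip j then (1 : ℝ) else 0) - (if z = base j then 1 else 0))
    (Nt : ν → ρ → ℝ) (hNt : ∀ j a, Nt j a = N (tip j) a) (hK₀ : K₀ᵀ = K₀) (hKD : K₀ * D = 0) (hKₛ : Kₛᵀ = -Kₛ) (s : ν)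
    (Wₛ : Matrix ν ρ ℝ) (h : Kₛ * (D * N) + K₀ * Wₛ = -Matrix.of (fun j a => K₀ j s * Nt j a)) (a a' : ρ) :
    ∑ j, K₀ j s * ((D * N) j a * (D * N) j a') = 0 := by
  have a0 : K₀ * (D * N) = 0 := by rw [← Matrix.mul_assoc, hKD, Matrix.zero_mul]
  have hS := sandwich_of_letter K₀ Kₛ (D * N) Wₛ _ hK₀ a0 h
  have hT := sandwich_add_transpose_of_antisymm Kₛ (D * N) _ hKₛ hS
  have h1 := congrFun (congrFun hT a') a
  rw [symPart_tip K₀ D N tip base hD Nt hNt s a a', Matrix.zero_apply] at h1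
  have hk : ∀ j, K₀ j s = K₀ s j := fun j => by
    have e := congrFun (congrFun hK₀ s) j
    rw [Matrix.transpose_apply] at e
    exact e
  have h0 : ∑ j, K₀ j s * (D *ᵥ fun z => N z a * N z a') j = 0 := by
    simp_rw [hk]
    have := congrFun (congrArg (fun M : Matrix ν X ℝ => M *ᵥ fun z => N z a * N z a') hKD) s
    simp only [Matrix.zero_mulVec, Pi.zero_apply, ← Matrix.mulVec_mulVec] at this
    rw [Matrix.mulVec, dotProduct] at this
    exact this
  simp only [mul_add, Finset.sum_add_distrib, h0, zero_add] at h1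
  exact h1

end Parity

end Summit.QuantumFields.BalabanUV.Beta.D1BFx.WardJetsSourcesParity

end
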